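import Literature.AnabelianGeometry.EtaleTheta.Discharge.Sec2Prop26TrueAtMonodromyModel
import Literature.AnabelianGeometry.EtaleTheta.Discharge.Sec2TemperedModelAutomorphisms
import Literature.AnabelianGeometry.EtaleTheta.Discharge.Sec2Cor29PreservedClosureRefuted
import HarnessLib

/-!
# [EtTh] Cor. 2.9, last sentence («these bijections are preserved by arbitrary isomorphisms `γ`»;
# `TemperedCoverData.Cor29_preserved`, FACT-LIST F-0601): INSTANCE FORMS at the monodromy model
# (proof-only companion of `ThetaCoversTempered.lean`; 0 definitions)

S. Mochizuki, *The étale theta function and its Frobenioid-theoretic manifestations* [EtTh], Publ. RIMS **45**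
(2009), §2, Cor. 2.9, PRIMS PDF p. 43 (printed 269) [cite: MochizukiEtTh2009, Cor 2.9 p.43]: «Suppose that `K` contains
a primitive `l`-th root of unity. Then for each of … `Ẋ̲̲, Ċ̲, Ċ̲̲, X̲̲, C̲, C̲̲`, the labels … determine a bijection of the set
`(ℤ/lℤ)^±` with the set of "Aut_K(−)"-orbits of the cusps … in the case of `X̲̲, C̲, C̲̲` these bijections are preserved by
arbitrary isomorphisms `γ` as in Corollary 2.8». The typer (abc-iut-L2-t2) records the last sentence as
`T.Cor29_preserved`: under `HasMuL`, every bi-continuous automorphism `Γ` of `Π^tp_C` stabilising the Prop. 2.4 list of the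
member and the cusp stabiliser `cuspStabC = N_{Π^tp_C}(tp D_x)` acts TRIVIALLY on the double-coset space
`N(Π^tp_Z) \ Π^tp_C / cuspStabC` of `Aut_K`-orbits of cusps. Its universal closure is REFUTED (abc-iut-f-142
`TwistedModel.not_forall_cor29_preserved_three`; abc-iut-f-141 at the Kummer-twist model, where the typed count
`Cor29_card` holds, `l ≥ 5`).

Cell abc-iut, block F (instance-form wave INST59, KEY INST59J1 row F-0601), seat abc-iut-f-108 (gen 4). WHAT THIS FILE
RECORDS, at abc-iut-w6-d084's MONODROMY MODEL `monodromyModel l hl : TemperedCoverData l` (`Π^tp_C = ((ℤ/l)² ⋊ D_∞) × ℤ/2`,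
the carrier at which the typed Prop. 2.6 HOLDS, `prop26_monodromyModel`; a DESIGNED toy with print's monodromy
combinatorics, `G_K = 1` — not the tempered `π₁` of a curve):
* `MonodromyModel.cuspStabC_monodromyModel` — the model's cusp decomposition datum `D_x = Φ⁻¹(Δ̄_Θ)` pulls back to a
  NORMAL subgroup of `Π^tp_C` (`Δ̄_Θ = ⟨z⟩` is central in the Heisenberg shadow, `heisTheta_comm`), so
  `cuspStabC = Π^tp_C`: the cusp stabiliser is DEGENERATE and every member has ONE `Aut_K`-orbit of cusps
  (`natCard_cuspOrbits_monodromyModel`);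
* `MonodromyModel.cor29_preserved_monodromyModel` — hence the typed `Cor29_preserved` HOLDS at the model (abc-iut-f-142's
  `cor29_preserved_of_cuspStabC_eq_top`), for the DEGENERATE reason; **INSTANCE FORM with no `Prop` hypothesis**:
  `cor29_preserved_monodromyModel_odd (k : ℕ)` at `l = 2k+1`, and CLOSED `cor29_preserved_monodromyModel_three` (`l = 3`);
* `MonodromyModel.not_cor29_card_monodromyModel` / `cor29_card_monodromyModel_one` — the typed COUNT `Cor29_card`
  (`#orbits = (l+1)/2`) FAILS there for `l ≥ 3` (one orbit) and HOLDS at the boundary value `l = 1` (`(1+1)/2 = 1`), where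
  therefore the whole typed Cor. 2.9 package `HasMuL ∧ Cor29_card ∧ Cor29_preserved` (and Prop. 2.6) holds at ONE carrier
  (`cor29_package_monodromyModel_one`; `l = 1` is a legal value of the interface — `CoverData.l_odd` — but degenerate:
  `(ℤ/1ℤ)^±` is a point);
* `cor29_preserved_instance_and_closure_refuted` — the census pair at `l = 3`.
HONEST FRAMING: a non-degenerate instance (a carrier with `(l+1)/2 ≥ 2` orbits at which every list-stabilising `Γ` fixes
them) is NOT given here and is not claimed; instances about OUR typed sentence at OUR toy carriers ≠ the printed corollary;
typed ≠ proved; refuted-as-typed ≠ refuted-in-print; no side is taken on [IUTchIII] Cor. 3.12 or on any author.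
-/

noncomputable section

namespace Literature.AnabelianGeometry.EtaleTheta.ThetaCovers.MonodromyModel

open HeisenbergWitness TemperedCoverData

variable (l : ℕ)

/-- `Δ̄_Θ = heisTheta` is a normal subgroup of the Heisenberg shadow (it is central, `heisTheta_comm`).
(toy bookkeeping; no claim about print) [cite: MochizukiEtTh2009, Rmk 2.6.1 p.40] -/
theorem heisTheta_normal : (heisTheta l).Normal := by
  refine ⟨fun t ht x => ?_⟩
  have h : x * t * x⁻¹ = t := by
    have := heisTheta_comm l x t ht
    rwa [mul_inv_eq_one] at this
  rw [h]
  exact ht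

variable [NeZero l]

/-- **The cusp stabiliser of the monodromy model is ALL of `Π^tp_C`**: `tp D_x = toHat⁻¹(Φ⁻¹(Δ̄_Θ))` is the pull-back of
the normal subgroup `Δ̄_Θ ◁ Heis`, hence normal, so its normaliser is `⊤` (DEGENERATE cusp datum of the toy).
[cite: MochizukiEtTh2009, Cor 2.9 p.43] -/
theorem cuspStabC_monodromyModel (hl : Odd l) : (monodromyModel l hl).cuspStabC = ⊤ := by
  haveI : ((monodromyModel l hl).tp (monodromyModel l hl).Dx).Normal := by
    change (((heisTheta l).comap (Phi l)).comap (toHat l).toMonoidHom).Normal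
    haveI := heisTheta_normal l
    infer_instance
  exact Subgroup.normalizer_eq_top (H := (monodromyModel l hl).tp (monodromyModel l hl).Dx)

/-- Hence every member of the tower has exactly ONE `Aut_K`-orbit of cusps at the monodromy model.
[cite: MochizukiEtTh2009, Cor 2.9 p.43] -/
theorem natCard_cuspOrbits_monodromyModel (hl : Odd l) (S : Subgroup (monodromyModel l hl).Gtp) :
    Nat.card ((monodromyModel l hl).cuspOrbits S) = 1 :=
  (monodromyModel l hl).natCard_cuspOrbits_of_cuspStabC_eq_top (cuspStabC_monodromyModel l hl) S

/-- **F-0601 HOLDS at the monodromy model** (every odd `l`), for the DEGENERATE reason `cuspStabC = Π^tp_C`: with one double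
coset, every `Γ` acts trivially on the orbit space (abc-iut-f-142's `cor29_preserved_of_cuspStabC_eq_top`).
[cite: MochizukiEtTh2009, Cor 2.9 p.43] -/
theorem cor29_preserved_monodromyModel (hl : Odd l) :
    Literature.AnabelianGeometry.EtaleTheta.ThetaCovers.TemperedCoverData.Cor29_preserved (monodromyModel l hl) :=
  (monodromyModel l hl).cor29_preserved_of_cuspStabC_eq_top (cuspStabC_monodromyModel l hl)

/-- **The typed COUNT `Cor29_card` FAILS at the monodromy model for `l ≥ 3`** (one orbit, but `(l+1)/2 ≥ 2`;
abc-iut-f-142's `not_cor29_card_of_cuspStabC_eq_top` with `hasMuL_monodromyModel`). [cite: MochizukiEtTh2009, Cor 2.9 p.43] -/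
theorem not_cor29_card_monodromyModel (hl : Odd l) (h3 : 3 ≤ l) : ¬ (monodromyModel l hl).Cor29_card :=
  (monodromyModel l hl).not_cor29_card_of_cuspStabC_eq_top (hasMuL_monodromyModel l hl)
    (cuspStabC_monodromyModel l hl) h3

end Literature.AnabelianGeometry.EtaleTheta.ThetaCovers.MonodromyModel

namespace Literature.AnabelianGeometry.EtaleTheta.ThetaCovers

open MonodromyModel

/-- **F-0601 INSTANCE FORM, no `Prop` hypothesis**: for every `k : ℕ`, the typed last sentence of Cor. 2.9 holds at the
monodromy model with `l = 2k+1` (degenerate cusp stabiliser; see `cor29_preserved_monodromyModel`).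
[cite: MochizukiEtTh2009, Cor 2.9 p.43] -/
theorem cor29_preserved_monodromyModel_odd (k : ℕ) :
    Literature.AnabelianGeometry.EtaleTheta.ThetaCovers.TemperedCoverData.Cor29_preserved
      (monodromyModel (2 * k + 1) ⟨k, rfl⟩) :=
  cor29_preserved_monodromyModel (2 * k + 1) ⟨k, rfl⟩

/-- **F-0601 CLOSED INSTANCE at `l = 3`** — the positive twin of abc-iut-f-142's closed refuter
`TwistedModel.not_forall_cor29_preserved_three` (both at `l = 3`: the typed sentence holds at one `TemperedCoverData 3` and
fails at another). [cite: MochizukiEtTh2009, Cor 2.9 p.43] -/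
theorem cor29_preserved_monodromyModel_three :
    Literature.AnabelianGeometry.EtaleTheta.ThetaCovers.TemperedCoverData.Cor29_preserved
      (monodromyModel 3 ⟨1, rfl⟩) :=
  cor29_preserved_monodromyModel 3 ⟨1, rfl⟩

/-- **At the boundary value `l = 1` the typed COUNT holds too**: `(1+1)/2 = 1` orbit for each of the six members.
(`l = 1` is a legal value of the typed interface, `CoverData.l_odd`; `(ℤ/1ℤ)^±` is a point — degenerate.)
[cite: MochizukiEtTh2009, Cor 2.9 p.43] -/
theorem cor29_card_monodromyModel_one :
    Literature.AnabelianGeometry.EtaleTheta.ThetaCovers.TemperedCoverData.Cor29_card (monodromyModel 1 ⟨0, rfl⟩) :=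
  fun _ S _ => natCard_cuspOrbits_monodromyModel 1 ⟨0, rfl⟩ S

/-- **The whole typed Cor. 2.9 at ONE carrier (boundary value `l = 1`)**: at `monodromyModel 1`, `K ⊇ μ_l` (`HasMuL`), the
count `Cor29_card`, the preservation `Cor29_preserved` AND the typed Prop. 2.6 all hold — the four typed sentences are
jointly consistent with the interface. Degenerate carrier (`l = 1`, one cusp orbit); no claim about print.
[cite: MochizukiEtTh2009, Cor 2.9 p.43] -/
theorem cor29_package_monodromyModel_one :
    (monodromyModel 1 ⟨0, rfl⟩).HasMuL ∧ (monodromyModel 1 ⟨0, rfl⟩).Cor29_card ∧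
      (monodromyModel 1 ⟨0, rfl⟩).Cor29_preserved ∧ (monodromyModel 1 ⟨0, rfl⟩).Prop26 :=
  ⟨hasMuL_monodromyModel 1 _, cor29_card_monodromyModel_one, cor29_preserved_monodromyModel 1 _,
    prop26_monodromyModel 1 _⟩

/-- **Census pair for F-0601 at `l = 3`**: the typed sentence HOLDS at a `TemperedCoverData 3` with `K ⊇ μ_3` (monodromy
model, degenerate cusp stabiliser) and its universal closure over `TemperedCoverData 3` is FALSE (abc-iut-f-142).
[cite: MochizukiEtTh2009, Cor 2.9 p.43] -/
theorem cor29_preserved_instance_and_closure_refuted :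
    (∃ T : TemperedCoverData.{0} 3, T.HasMuL ∧ T.Cor29_preserved) ∧
      ¬ ∀ T : TemperedCoverData.{0} 3, T.Cor29_preserved :=
  ⟨⟨monodromyModel 3 ⟨1, rfl⟩, hasMuL_monodromyModel 3 _, cor29_preserved_monodromyModel_three⟩,
    TwistedModel.not_forall_cor29_preserved_three⟩

end Literature.AnabelianGeometry.EtaleTheta.ThetaCovers

end
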